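import Summits.Parity.BatemanHorn.Theses.RoughValueTransport
import Summits.Parity.BatemanHorn.Theorems.RoughValueTransportRoughValueLawSieveBand
import Summits.Parity.BatemanHorn.Theorems.RoughValueTransportSieveCalibrationMertens
import HarnessLib

/-!
# Route `RoughValueTransport`, support item `SieveCalibration` (stmt-Parity-11391)

We PROVE `Summit.Parity.BatemanHorn.Theses.RoughValueTransport.SieveCalibration`
(`sieveCalibration_proof`): for every Bateman–Horn system `f = (f₁, …, f_k)` and every family of
rough-value limits `L(u) = lim_x Φ_f(x,u)·(log x)^k/x` (`u ≥ u₀`),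
`L(u)/u^k → (C(f)/∏ deg fᵢ)·e^{−kγ}` as `u → ∞`.

Inputs, both PROVED in the tree:
* the two-sided fundamental lemma along `f` as a relative band,
  `Summit.Parity.BatemanHorn.Cruxes.RoughValueLaw.IncrementAnchoring.stub_sieveBand`
  (`Theorems/RoughValueTransportRoughValueLawSieveBand.lean`): for `U ≥ U₁(ε)`, eventually in `x`,
  `|Φ_f(x,U) − x·V_f(x,U)| ≤ ε·x·V_f(x,U)`;
* Mertens with staggered thresholds, `SieveCalibration.tendsto_log_pow_mul_staggeredProd`
  (`Theorems/RoughValueTransportSieveCalibrationMertens.lean`):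
  `(log x)^k · V_f(x,U) → c·U^k`, `c = (C(f)/∏ deg fᵢ)e^{−kγ}`, for `U ≥ max deg fᵢ`.

Squeeze (`sieveCalibration_proof`): for `u ≥ max(u₀, U₁(ε/2c), ∑ deg fᵢ, 1)` the assumed limit
`L(u)` lies in `[(1 − ε/2c)·c·u^k, (1 + ε/2c)·c·u^k]` (`SieveCalibration.sandwich_of_band`,
`le_of_tendsto_of_tendsto`), i.e. `|L(u)/u^k − c| ≤ ε/2 < ε`.  The case `k = 0` needs no separate
treatment (`V = 1`, `C(∅) = 1`, both sides are `1`).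

References: H. Halberstam, H.-E. Richert, *Sieve Methods* (1974), Thm 2.5 and §5;
P. T. Bateman, R. A. Horn, Math. Comp. 16 (1962), §2.
-/

noncomputable section

open Filter Finset Polynomial
open scoped Topology BigOperators
open Literature.NumberTheory.Sieve

namespace Summit.Parity.BatemanHorn.Theorems

/-- Sandwich bookkeeping: a relative band `|Φ − xV| ≤ e·xV` gives
`(1 − e)·(ℓ V) ≤ Φ ℓ/x ≤ (1 + e)·(ℓ V)` for `x > 0`, `ℓ ≥ 0`. [folklore] -/
theorem SieveCalibration.sandwich_of_band {Φ x V e lk : ℝ} (hx : 0 < x) (hlk : 0 ≤ lk)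
    (hb : |Φ - x * V| ≤ e * (x * V)) :
    (1 - e) * (lk * V) ≤ Φ * lk / x ∧ Φ * lk / x ≤ (1 + e) * (lk * V) := by
  rw [abs_le] at hb
  obtain ⟨h1, h2⟩ := hb
  constructor
  · rw [le_div_iff₀ hx]
    have h : (1 - e) * (x * V) ≤ Φ := by linarith
    calc (1 - e) * (lk * V) * x = (1 - e) * (x * V) * lk := by ring
      _ ≤ Φ * lk := mul_le_mul_of_nonneg_right h hlk
  · rw [div_le_iff₀ hx]
    have h : Φ ≤ (1 + e) * (x * V) := by linarith
    calc Φ * lk ≤ (1 + e) * (x * V) * lk := mul_le_mul_of_nonneg_right h hlk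
      _ = (1 + e) * (lk * V) * x := by ring

/-- **`SieveCalibration` (item stmt-Parity-11391 of route `RoughValueTransport`).**  For every
Bateman–Horn system `f` of `k` polynomials and every family of rough-value limits
`L(u) = lim_x Φ_f(x,u)·(log x)^k/x` (`u ≥ u₀`), `L(u)/u^k → (C(f)/∏ deg fᵢ)·e^{−kγ}` as `u → ∞`.
Proof: the PROVED band `stub_sieveBand` (`|Φ_f(x,u) − xV_f(x,u)| ≤ ε'xV_f(x,u)` for `u ≥ U₁(ε')`,
eventually in `x`) and Mertens with staggered thresholds
(`SieveCalibration.tendsto_log_pow_mul_staggeredProd`: `(log x)^k V_f(x,u) → c·u^k`,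
`c = (C(f)/∏ deg fᵢ)e^{−kγ}`, for `u ≥ ∑ deg fᵢ`) squeeze `L(u)` in `[(1−ε')c u^k, (1+ε')c u^k]`;
with `ε' = ε/(2c)` this is `|L(u)/u^k − c| ≤ ε/2 < ε` for `u ≥ max(u₀, U₁, ∑ deg fᵢ, 1)`. [folklore] -/
theorem sieveCalibration_proof :
    Summit.Parity.BatemanHorn.Theses.RoughValueTransport.SieveCalibration := by
  unfold Summit.Parity.BatemanHorn.Theses.RoughValueTransport.SieveCalibration
  intro k f hf L hL
  obtain ⟨u₀, hL⟩ := hL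
  obtain ⟨c, hc_def⟩ : ∃ c : ℝ, c = batemanHornConst f / (∏ i, ((f i).natDegree : ℝ)) *
      Real.exp (-((k : ℝ) * Real.eulerMascheroniConstant)) := ⟨_, rfl⟩
  have hCf : 0 < batemanHornConst f := (IsBatemanHornSystem.hasBatemanHornConst_holds hf).2
  have hD : (0 : ℝ) < ∏ i, ((f i).natDegree : ℝ) :=
    prod_pos fun i _ => by exact_mod_cast hf.natDegree_pos i
  have hc : 0 < c := by rw [hc_def]; positivity
  have hc0 : c ≠ 0 := hc.ne'
  rw [← hc_def, Metric.tendsto_atTop]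
  intro ε hε
  have hε' : 0 < ε / (2 * c) := by positivity
  obtain ⟨U₁, hU₁⟩ :=
    Summit.Parity.BatemanHorn.Cruxes.RoughValueLaw.IncrementAnchoring.stub_sieveBand k f hf
      (ε / (2 * c)) hε'
  have hdS : ∀ i, ((f i).natDegree : ℝ) ≤ ((∑ j, (f j).natDegree : ℕ) : ℝ) := fun i => by
    exact_mod_cast Finset.single_le_sum (f := fun j => (f j).natDegree) (fun j _ => Nat.zero_le _)
      (mem_univ i)
  refine ⟨max (max u₀ U₁) (max ((∑ j, (f j).natDegree : ℕ) : ℝ) 1), fun u hu => ?_⟩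
  have hu₀ : u₀ ≤ u := le_trans (le_trans (le_max_left _ _) (le_max_left _ _)) hu
  have hU₁u : U₁ ≤ u := le_trans (le_trans (le_max_right _ _) (le_max_left _ _)) hu
  have hSu : ((∑ j, (f j).natDegree : ℕ) : ℝ) ≤ u :=
    le_trans (le_trans (le_max_left _ _) (le_max_right _ _)) hu
  have hu1 : 1 ≤ u := le_trans (le_trans (le_max_right _ _) (le_max_right _ _)) hu
  have hu0 : 0 < u := by linarith
  have huk : 0 < u ^ k := pow_pos hu0 k
  have hdeg : ∀ i, ((f i).natDegree : ℝ) ≤ u := fun i => (hdS i).trans hSu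
  have hlim := hL u hu₀
  have hband := hU₁ u hU₁u
  have hM := SieveCalibration.tendsto_log_pow_mul_staggeredProd k f hf u hdeg
  rw [← hc_def] at hM
  -- the squeeze
  have hup : L u ≤ (1 + ε / (2 * c)) * (c * u ^ k) := by
    refine le_of_tendsto_of_tendsto hlim (hM.const_mul (1 + ε / (2 * c))) ?_
    filter_upwards [hband, eventually_ge_atTop 1] with x hb hx1
    have hx0 : (0 : ℝ) < x := Nat.cast_pos.mpr (by omega)
    have hlog : 0 ≤ Real.log x ^ k := pow_nonneg (Real.log_nonneg (by exact_mod_cast hx1)) k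
    exact (SieveCalibration.sandwich_of_band hx0 hlog hb).2
  have hlow : (1 - ε / (2 * c)) * (c * u ^ k) ≤ L u := by
    refine le_of_tendsto_of_tendsto (hM.const_mul (1 - ε / (2 * c))) hlim ?_
    filter_upwards [hband, eventually_ge_atTop 1] with x hb hx1
    have hx0 : (0 : ℝ) < x := Nat.cast_pos.mpr (by omega)
    have hlog : 0 ≤ Real.log x ^ k := pow_nonneg (Real.log_nonneg (by exact_mod_cast hx1)) k
    exact (SieveCalibration.sandwich_of_band hx0 hlog hb).1
  have key : ε / (2 * c) * c = ε / 2 := by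
    rw [div_mul_eq_mul_div, mul_div_mul_right _ _ hc0]
  have h1 : L u / u ^ k ≤ c + ε / 2 := by
    rw [div_le_iff₀ huk]
    calc L u ≤ (1 + ε / (2 * c)) * (c * u ^ k) := hup
      _ = (c + ε / (2 * c) * c) * u ^ k := by ring
      _ = (c + ε / 2) * u ^ k := by rw [key]
  have h2 : c - ε / 2 ≤ L u / u ^ k := by
    rw [le_div_iff₀ huk]
    calc (c - ε / 2) * u ^ k = (c - ε / (2 * c) * c) * u ^ k := by rw [key]
      _ = (1 - ε / (2 * c)) * (c * u ^ k) := by ring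
      _ ≤ L u := hlow
  rw [Real.dist_eq, abs_sub_lt_iff]
  constructor <;> linarith

end Summit.Parity.BatemanHorn.Theorems

end
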